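import Summits.HodgeConjecture.CorCM.GaloisAnnihilatorCertificates
import HarnessLib

/-!
# BAD certificates times a real quadratic factor: `T₀ ⊔ (T₀w)·t` on `Γ₀ × C₂`

COR-CM (cell `pub-hodgecm2`), binder seat b04 (gen 30), count-neutral own lane «Galois-CM-type classification» (which Galois CM
fields `(G, c)` have ALL primitive CM types nondegenerate = GOOD, vs. a primitive degenerate type = BAD).  KERNEL ONLY: theorems;
no definition, no named fact, no `sorry`.  `HC_CM` is neither used nor claimed.

Companion of `CorCM/GaloisCertificateTimesCyclic` (`× C_n`, `n ≥ 3`, no hypothesis).  For the factor `C₂` the lifted type is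
`T = T₀ × {1} ⊔ (T₀ w) × {t}` for a chosen `w ∈ Γ₀` — the right translate `T₀ w` is annihilated by the same `b` — and `T` is
primitive iff `T₀ w` is NOT a left translate `a T₀` (then `(a, t)` would stabilise `T`; necessarily `a² = 1`).  This is the extra,
DECIDABLE hypothesis `hw : ∀ a, ∃ g, ¬ (g ∈ T₀ ↔ a g w⁻¹ ∈ T₀)`; it can always be met unless `Γ₀` is an elementary abelian
`2`-group (the map `w ↦ a_w` would be an injective homomorphism onto a group of exponent `2`), but here it is simply an input checked
per certificate (e.g. by `decide` on a table model).

THEOREM (**`exists_simple_degenerate_prod_two_of_certificate`**).  `e : Gal(K/ℚ) ≃* Γ₀ × C₂` with complex conjugation `(c₀, 1)`,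
an annihilator certificate `(T₀, b)` for `(Γ₀, c₀)` (gen 24 format) and `w` with `hw` ⟹ `K` carries a SIMPLE DEGENERATE abelian
variety of dimension `|Γ₀|` with CM by `K` (rational `(p,p)` class outside the divisor ring on some power).  Use: lift the table
certificates of `D₁₆`, `SD₃₂`, `M₃₂`, the order-24/32 rows, … to `× C₂` (order 64, …) with one `decide` for `hw`.

## References

* [Kubota1965] T. Kubota, *On the field extension by complex multiplication*, Trans. AMS 118 (1965), §2, §4 Lemma 2.
* [Shimura1998] G. Shimura, *Abelian Varieties with Complex Multiplication and Modular Functions*, §6.2 Thm. 3, §8.2 Prop. 26.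
* [Gordon1999HodgeAVSurvey] B. B. Gordon, *A survey of the Hodge conjecture for abelian varieties*, Thm. 6.4, §9.3.
-/

noncomputable section

open CategoryTheory CategoryTheory.Limits NumberField
open scoped BigOperators

namespace Summit.HodgeConjecture.CorCM.GaloisModels

open Literature.NumberTheory.ComplexMultiplication
open Literature.AlgebraicGeometry.Motives (AbelianVariety CMType)
open Literature.AlgebraicGeometry.HodgeTheory
open Literature.AlgebraicGeometry.ComplexMultiplication (IsCMTypeRealisation)
open Literature.AlgebraicGeometry.Pohlmann1968
open Literature.Barriers.HodgeConjecture (divisorClassesSpan)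

section Field

variable {Γ₀ : Type*} [Group Γ₀] [Fintype Γ₀] [DecidableEq Γ₀]
variable {K : Type} [Field K] [NumberField K] [IsCMField K] [IsGalois ℚ K]

/-- **A CERTIFIED-BAD GROUP TIMES `C₂`** with a right translate `T₀w` that is no left translate of `T₀`: `e : Gal(K/ℚ) ≃* Γ₀ × C₂`,
complex conjugation `(c₀, 1)`; `(T₀, b)` an annihilator certificate for `(Γ₀, c₀)`; `w ∈ Γ₀` with
`∀ a, ∃ g, ¬ (g ∈ T₀ ↔ a g w⁻¹ ∈ T₀)` ⟹ `K` carries a SIMPLE DEGENERATE abelian variety of dimension `|Γ₀|` with CM by `K` (rational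
`(p,p)` class outside the divisor ring on some power) — the type `T₀ × {1} ⊔ (T₀w) × {t}`.
[cite: Kubota1965, §2 and §4 Lemma 2] [cite: Shimura1998, §6.2 Thm. 3 and §8.2 Prop. 26] [cite: Gordon1999HodgeAVSurvey, Thm. 6.4 and §9.3] -/
theorem exists_simple_degenerate_prod_two_of_certificate (e : (K ≃ₐ[ℚ] K) ≃* Γ₀ × Multiplicative (ZMod 2)) (c₀ : Γ₀)
    (hc : e ((IsCMField.complexConj K).restrictScalars ℚ) = (c₀, 1)) (T₀ : Finset Γ₀)
    (hcm : ∀ x : Γ₀, x ∈ T₀ ↔ c₀ * x ∉ T₀) (hprim : ∀ v : Γ₀, v ≠ 1 → ∃ g : Γ₀, ¬ (g ∈ T₀ ↔ v * g ∈ T₀))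
    (b : Γ₀ → ℤ) (hanti : ∀ y, b (c₀ * y) = -b y) (hann : ∀ g : Γ₀, ∑ s ∈ T₀, b (s * g) = 0) (hb : ∃ y, b y ≠ 0)
    (w : Γ₀) (hw : ∀ a : Γ₀, ∃ g : Γ₀, ¬ (g ∈ T₀ ↔ a * g * w⁻¹ ∈ T₀)) :
    ∃ (Φ : CMType K) (φ₀ : K →+* ℂ) (X : AbelianVariety ℂ) (ι : 𝓞 K →+* End X)
      (ϑ : K →+* Module.End ℂ (complexBetti X.X 1)),
      IsPrimitive (ℂ ≃+* ℂ) Φ.1 φ₀ ∧ ¬ IsNondegenerate Φ ∧ IsCMTypeRealisation Φ X ι ϑ ∧ X.IsSimple ∧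
      X.dim = Fintype.card Γ₀ ∧
      ∃ m p : ℕ, ∃ y : complexBetti (⨁ fun _ : Fin m => X).X (2 * p), IsRationalClass y ∧
        IsOfHodgeType (⨁ fun _ : Fin m => X).dim (⨁ fun _ : Fin m => X).X (2 * p) p p y ∧
        y ∉ divisorClassesSpan (⨁ fun _ : Fin m => X).X (⨁ fun _ : Fin m => X).dim p := by
  classical
  set t : Multiplicative (ZMod 2) := Multiplicative.ofAdd 1 with ht_def
  have ht1 : t ≠ 1 := by decide
  have htt : t * t = 1 := by decide
  have h01 : ∀ v : Multiplicative (ZMod 2), v = 1 ∨ v = t := by decide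
  -- the lifted type `T₀ × {1} ⊔ (T₀ w) × {t}`
  set T : Finset (Γ₀ × Multiplicative (ZMod 2)) :=
    Finset.univ.filter fun z => if z.2 = t then z.1 * w⁻¹ ∈ T₀ else z.1 ∈ T₀ with hT_def
  have hT1 : ∀ g : Γ₀, (g, (1 : Multiplicative (ZMod 2))) ∈ T ↔ g ∈ T₀ := fun g => by
    simp only [hT_def, Finset.mem_filter, Finset.mem_univ, true_and, if_neg ht1.symm]
  have hTt : ∀ g : Γ₀, (g, t) ∈ T ↔ g * w⁻¹ ∈ T₀ := fun g => by
    simp only [hT_def, Finset.mem_filter, Finset.mem_univ, true_and, if_true]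
  -- CM
  have hcm' : ∀ z, z ∈ T ↔ ((c₀, 1) : Γ₀ × Multiplicative (ZMod 2)) * z ∉ T := by
    rintro ⟨g, v⟩
    rw [Prod.mk_mul_mk, one_mul]
    rcases h01 v with rfl | rfl
    · rw [hT1, hT1]; exact hcm g
    · rw [hTt, hTt, mul_assoc]; exact hcm (g * w⁻¹)
  -- trivial left stabiliser
  have hprim' : ∀ z : Γ₀ × Multiplicative (ZMod 2), z ≠ 1 → ∃ s, ¬ (s ∈ T ↔ z * s ∈ T) := by
    rintro ⟨a, κ⟩ hne
    rcases h01 κ with rfl | rfl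
    · have ha : a ≠ 1 := fun h => hne (by rw [h]; rfl)
      obtain ⟨g, hg⟩ := hprim a ha
      refine ⟨(g, 1), ?_⟩
      rwa [Prod.mk_mul_mk, mul_one, hT1, hT1]
    · obtain ⟨g, hg⟩ := hw a
      refine ⟨(g, 1), ?_⟩
      rwa [Prod.mk_mul_mk, mul_one, hT1, hTt]
  -- the lifted annihilator
  let B : Γ₀ × Multiplicative (ZMod 2) → ℤ := fun z => if z.2 = 1 then b z.1 else 0
  have hanti' : ∀ z, B (((c₀, 1) : Γ₀ × Multiplicative (ZMod 2)) * z) = -B z := by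
    rintro ⟨g, v⟩
    simp only [B, Prod.mk_mul_mk, one_mul]
    split_ifs
    · exact hanti g
    · simp
  have hann' : ∀ z : Γ₀ × Multiplicative (ZMod 2), ∑ s ∈ T, B (s * z) = 0 := by
    rintro ⟨g, v⟩
    -- only the fibre over `v⁻¹ = v` contributes, and it is `T₀` or `T₀ w`
    rw [show (∑ s ∈ T, B (s * (g, v))) = ∑ s ∈ T, (if (s * (g, v)).2 = 1 then b (s * (g, v)).1 else 0) from rfl,
      Finset.sum_ite, Finset.sum_const_zero, add_zero]
    have hset : (T.filter fun s => (s * (g, v)).2 = 1) =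
        (Finset.univ.filter fun h : Γ₀ => if v = t then h * w⁻¹ ∈ T₀ else h ∈ T₀).image fun h => (h, v) := by
      ext ⟨h, u⟩
      simp only [hT_def, Finset.mem_filter, Finset.mem_univ, true_and, Finset.mem_image, Prod.mk_mul_mk, Prod.mk.injEq]
      constructor
      · rintro ⟨hm, hu⟩
        have hu' : u = v := by
          rcases h01 u with rfl | rfl <;> rcases h01 v with rfl | rfl
          · rfl
          · rw [one_mul] at hu; exact absurd hu ht1
          · rw [mul_one] at hu; exact absurd hu ht1
          · rfl
        subst hu'
        exact ⟨h, hm, rfl, rfl⟩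
      · rintro ⟨h', hm, rfl, rfl⟩
        refine ⟨hm, ?_⟩
        rcases h01 v with rfl | rfl
        · exact mul_one 1
        · exact htt
    rw [hset, Finset.sum_image (fun x _ y _ hxy => (Prod.mk.inj hxy).1)]
    simp only [Prod.mk_mul_mk]
    rcases h01 v with rfl | rfl
    · simp only [if_neg ht1.symm]
      have hT : (Finset.univ.filter fun h : Γ₀ => h ∈ T₀) = T₀ := by ext h; simp
      rw [hT]; exact hann g
    · simp only [if_true]
      -- `{h : h w⁻¹ ∈ T₀} = T₀ w`, and `Σ_{h ∈ T₀ w} b(h g) = Σ_{s ∈ T₀} b(s (w g)) = 0`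
      have hset' : (Finset.univ.filter fun h : Γ₀ => h * w⁻¹ ∈ T₀) = T₀.image fun s => s * w := by
        ext h
        simp only [Finset.mem_filter, Finset.mem_univ, true_and, Finset.mem_image]
        constructor
        · intro hh; exact ⟨h * w⁻¹, hh, inv_mul_cancel_right h w⟩
        · rintro ⟨s, hs, rfl⟩; rwa [mul_inv_cancel_right]
      rw [hset', Finset.sum_image (fun x _ y _ hxy => mul_right_cancel hxy)]
      simp only [mul_assoc]
      exact hann (w * g)
  have hb' : ∃ z, B z ≠ 0 := by
    obtain ⟨y, hy⟩ := hb
    exact ⟨(y, 1), by simpa [B] using hy⟩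
  obtain ⟨Φ, φ₀, X, ι, ϑ, h1, h2, h3, h4, h5, h6⟩ :=
    exists_simple_degenerate_of_model_annihilator e (c₀, 1) hc T hcm' hprim' B hanti' hann' hb'
  refine ⟨Φ, φ₀, X, ι, ϑ, h1, h2, h3, h4, ?_, h6⟩
  rw [h5, Fintype.card_prod, Fintype.card_multiplicative, ZMod.card, Nat.mul_div_cancel _ Nat.two_pos]

end Field

end Summit.HodgeConjecture.CorCM.GaloisModels

end
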